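import Literature.AlgebraicGeometry.Motives.IntegralModelReductionMapAbelianScheme
import Literature.AlgebraicGeometry.Motives.IntegralModelTensorReductionMap
import Literature.NumberTheory.Automorphic.Liu2021.AppendixC.EichlerShimuraPointwiseAssembly
import Literature.NumberTheory.Automorphic.Liu2021.AppendixC.AlbaneseFiniteQuotientTraceHolds
import Literature.NumberTheory.Automorphic.Liu2021.NablaTransitive
import HarnessLib

/-!
# Eichler–Shimura on points: the difference function `θ` on the special fibre (the geometric instantiation of the pairing bookkeeping)
# ([Liu2021] App. D, proof of Cor. D.9 (p. 139); [DiamondShurman2005] Thm. 8.7.2; [SerreTate1968] §1)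

Topic `Literature/NumberTheory/Automorphic/Liu2021/AppendixC`.  THEOREMS only (no def, no instance, no notation, no named fact, no `sorry`).
Cell `hodgecm-mathlib` (D-0151), FLOOR 0, programme F0P5a (D9op road 2′, crux item stmt-HodgeConjecture-24832): piece **(A′)** of the ED. 4
composition of `Cruxes/HLiu418/Lines/F0_D9opRoad2.lean` (F0P5a-p02 (g0) hand-back memo `ED4-PEN-HANDBACK.v0` §2 step 6, first half; F0P5a
LEAD WORD 2026-08-30T23:32Z): the ten structural hypotheses `red, hred, rel, hrefl, hsymm, htrans, hπ0, αu, hcoc, αr, hαr` of the PURE-ALGEBRA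
step ★ `EichlerShimuraAssembly.exists_sub_eq_of_cocycle` / ★ `EichlerShimuraAssembly.sum_pairing_eq_of_multiset_eq_of_rel` (file (A), p795049)
DISCHARGED ONCE in the geometry of the letter `RecordCurveEichlerShimuraPointwise`, generically (no Shimura datum, no Frobenius, no Hecke
operator appears):

* upstairs `Q := X(Ω)` (`Ω = \overline{K_v}`), the relation `rel p q :⟺ (p, q)` lies on `∇X` (★ `AppendixC.Nabla`: reflexive by the
  diagonal, symmetric ★ `Nabla.exists_swap`, transitive ★ `Nabla.isTransitive_of_isProjectiveOver`), the upstairs difference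
  `αu p q := red_{⟨𝒜,e⟩} (αd (p, q))` — the reduction (★ `IntegralModel.geomReductionMap` of the abelian-scheme model `𝒜` of `B`) of the value
  of the EXTENDED Albanese difference morphism `αd : X × X → B` (`∇X ↪ X × X ≫ αd = β`, `β` a cocycle ★ `Nabla.IsCocycle`, e.g. the
  Albanese morphism `α_X` by ★ `Albanese.isCocycle_of_isProjectiveOver'`), a cocycle on `∇`-triples because `red_{⟨𝒜,e⟩}` is a
  homomorphism (★ `IsAbelianSchemeModel.integralModel_geomReductionMap_mul`);
* downstairs `P := 𝒮_v(κ̄(v))` for a PROPER model `𝒮` of `X`, `red := red_𝒮` (★ `IntegralModel.geomReductionMap`) — SURJECTIVE (letter H at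
  `𝒮`, a HYPOTHESIS here) and SEPARATING `∇`-classes (letter π0 at `𝒮`, a HYPOTHESIS here) —, and the downstairs difference
  `αr a b := 𝔞_v (a, b)` for an `𝓞ᵥ`-morphism `𝔞 : 𝒮 × 𝒮 → 𝒜` with generic fibre `αd` (the Néron extension), which agrees with `αu` on
  reductions by C2 (★ `IsAbelianSchemeModel.integralModel_geomReductionMap_map_of_μ_additive` + ★ `IntegralModel.geomReductionMap_tensor_lift`).

## What is proved

* §0 `IsAbelianSchemeModel.integralModel_geomReductionMap_map_of_μ_geomPoints` / `…_map_lift_geomPoints` — ★ C2 (p793967) re-read with both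
  sides in `h.specialFibre.geomPoints` (the elaboration convention of the letter's terms, so that `rw` fires inside `Hom.geomPointsMap 𝒯̄ (…)`).
* `Nabla.exists_theta_of_isCocycle` — **there is `θ : 𝒮_v(κ̄) → 𝒜_v(κ̄)` with `𝔞_v (red p, red q) = θ (red p) − θ (red q)` for every pair
  `(p, q) ∈ ∇X(Ω)`** (additively written in `h.specialFibre.geomPoints`, the currency of the letter);
* `Albanese.exists_theta` / `Albanese.exists_theta_of_isSmoothProper` — the same for an Albanese datum `aX` of a smooth projective `X`
  (cocycle and transitivity discharged by ★), `𝒮` proper resp. `𝒮.IsSmoothProper e` (the letter's binder);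
* `Nabla.sum_pairing_eq_of_multiset_eq` / `Albanese.sum_pairing_eq_of_multiset_eq` — ★ (A) `sum_pairing_eq_of_multiset_eq_of_rel` with its ten
  structural arguments discharged: for `∇`-pairs `(paᵢ, pbᵢ)`, `(px, py)`, `(pcⱼ, pdⱼ)` of `Ω`-points whose REDUCTIONS satisfy the two multiset
  identities `Σᵢ {red paᵢ} = {red px} + Σⱼ n • {red pcⱼ}`, `Σᵢ {red pbᵢ} = {red py} + Σⱼ n • {red pdⱼ}` (letter C3 at two points, after the
  Frobenius rewrite of letter Fr), `Σᵢ 𝔞_v (red paᵢ, red pbᵢ) = 𝔞_v (red px, red py) + n • Σⱼ 𝔞_v (red pcⱼ, red pdⱼ)` — the PAIRING of the two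
  Hecke orbits is irrelevant; and the upstairs reading `Σᵢ red_{⟨𝒜,e⟩} (αd (paᵢ, pbᵢ)) = …` (`…_upstairs`).

HC_CM is proved only modulo the 7 printed citations until rung 0 closes; this file is a generic leaf and changes no count.

## References
* [Liu2021] Y. Liu, *Fourier–Jacobi cycles and arithmetic relative trace formula*, Camb. J. Math. 9 (2021), App. D proof of Cor. D.9 (print
  p. 139), §2.1 Def. 2.1 (1), Def. 2.3.
* [DiamondShurman2005] F. Diamond, J. Shurman, *A First Course in Modular Forms*, Thm. 8.7.2 (p. 353) (Eichler–Shimura on points / divisors).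
* [SerreTate1968] J.-P. Serre, J. Tate, *Good reduction of abelian varieties*, Ann. of Math. 88 (1968), §1 (the reduction map is a homomorphism).
* [BLRNeronModels1990] S. Bosch, W. Lütkebohmert, M. Raynaud, *Néron Models*, §1.2 Prop. 8 (extension of morphisms to Néron models).
* [GortzWedhorn2020] U. Görtz, T. Wedhorn, *Algebraic Geometry I* (2nd ed.), Section (4.7) (points of fibre products).
-/

set_option autoImplicit false

noncomputable section

open CategoryTheory CategoryTheory.Limits AlgebraicGeometry MonoidalCategory CartesianMonoidalCategory
open IsDedekindDomain IsDedekindDomain.HeightOneSpectrum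
open scoped NumberField
open Literature.AlgebraicGeometry.Motives (SchemeOver AbelianVariety AlgPoints IntegralModel IsProjectiveOver)
open Literature.NumberTheory.EllipticCurves (genericFibre)
open Literature.NumberTheory.DiophantineGeometry (IsAbelianSchemeModel specialFibreFunctor geomResidueField)

namespace Literature.NumberTheory.Automorphic.Liu2021.AppendixC

variable {K : Type} [Field K] [NumberField K] {v : HeightOneSpectrum (𝓞 K)} {X : SchemeOver K}
  {B : AbelianVariety K} {𝒜 : SchemeOver (valuationSubringAtPrime K v)} [GrpObj 𝒜]

/-! ### §0 C2 read in the currency of the letter (`Additive.ofMul (AlgPoints.map ((specialFibreFunctor v).map 𝔞) ·) : h.specialFibre.geomPoints`) -/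

/-- ★ C2 `IsAbelianSchemeModel.integralModel_geomReductionMap_map_of_μ_additive` with BOTH sides read in `h.specialFibre.geomPoints` — i.e. the
right-hand side `Additive.ofMul (𝔞_v (red_{𝒳⊗𝒴} x))` elaborated at the expected type `h.specialFibre.geomPoints`, which is how the terms of the
letter `RecordCurveEichlerShimuraPointwise` (inside `Hom.geomPointsMap (h.specialFibreHom h 𝒯) (Additive.ofMul (AlgPoints.map ((specialFibreFunctor v).map 𝔞) ·))`)
elaborate (`AlgPoints.map` at codomain `h.specialFibre.X`, ★ `specialFibre_X` by `rfl`); `rw` with the ★ form does not fire on such terms, this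
form does (same proof term). [cite: SerreTate1968, §1] [cite: BLRNeronModels1990, §1.2 Prop. 8] -/
theorem _root_.Literature.NumberTheory.DiophantineGeometry.IsAbelianSchemeModel.integralModel_geomReductionMap_map_of_μ_geomPoints
    (h : IsAbelianSchemeModel B v 𝒜) {Y : SchemeOver K}
    (𝒳 : IntegralModel (valuationSubringAtPrime K v) K X) (𝒴 : IntegralModel (valuationSubringAtPrime K v) K Y)
    [IsProper 𝒳.total.hom] [IsProper 𝒴.total.hom] (αd : X ⊗ Y ⟶ B.X) (𝔞 : 𝒳.total ⊗ 𝒴.total ⟶ 𝒜)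
    (h𝔞 : Functor.LaxMonoidal.μ (genericFibre (valuationSubringAtPrime K v) K) 𝒳.total 𝒴.total ≫
        (genericFibre (valuationSubringAtPrime K v) K).map 𝔞 ≫ h.exists_iso.choose.hom = (𝒳.genericIso.hom ⊗ₘ 𝒴.genericIso.hom) ≫ αd)
    (x : AlgPoints (X ⊗ Y) (AlgebraicClosure (v.adicCompletion K))) :
    (Additive.ofMul (haveI := h.isProper
     (⟨𝒜, h.exists_iso.choose⟩ : IntegralModel (valuationSubringAtPrime K v) K B.X).geomReductionMap (AlgPoints.map αd x)) :
        h.specialFibre.geomPoints) =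
      (Additive.ofMul (AlgPoints.map ((specialFibreFunctor v).map 𝔞)
        (haveI := IntegralModel.isProper_tensor_total 𝒳 𝒴; (𝒳.tensor 𝒴).geomReductionMap x)) : h.specialFibre.geomPoints) :=
  h.integralModel_geomReductionMap_map_of_μ_additive 𝒳 𝒴 αd 𝔞 h𝔞 x

/-- **C2 on a pair, in the currency of the letter**: `red_{⟨𝒜,e⟩} (αd (x₁, x₂)) = 𝔞_v (red_𝒳 x₁, red_𝒴 x₂)` in `h.specialFibre.geomPoints`
(★ `integralModel_geomReductionMap_map_of_μ_additive` + ★ `IntegralModel.geomReductionMap_tensor_lift`; ED4 §8 steps 2 and 5).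
[cite: SerreTate1968, §1] [cite: BLRNeronModels1990, §1.2 Prop. 8] [cite: GortzWedhorn2020, Section (4.7)] -/
theorem _root_.Literature.NumberTheory.DiophantineGeometry.IsAbelianSchemeModel.integralModel_geomReductionMap_map_lift_geomPoints
    (h : IsAbelianSchemeModel B v 𝒜) {Y : SchemeOver K}
    (𝒳 : IntegralModel (valuationSubringAtPrime K v) K X) (𝒴 : IntegralModel (valuationSubringAtPrime K v) K Y)
    [IsProper 𝒳.total.hom] [IsProper 𝒴.total.hom] (αd : X ⊗ Y ⟶ B.X) (𝔞 : 𝒳.total ⊗ 𝒴.total ⟶ 𝒜)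
    (h𝔞 : Functor.LaxMonoidal.μ (genericFibre (valuationSubringAtPrime K v) K) 𝒳.total 𝒴.total ≫
        (genericFibre (valuationSubringAtPrime K v) K).map 𝔞 ≫ h.exists_iso.choose.hom = (𝒳.genericIso.hom ⊗ₘ 𝒴.genericIso.hom) ≫ αd)
    (x₁ : AlgPoints X (AlgebraicClosure (v.adicCompletion K))) (x₂ : AlgPoints Y (AlgebraicClosure (v.adicCompletion K))) :
    (Additive.ofMul (haveI := h.isProper
     (⟨𝒜, h.exists_iso.choose⟩ : IntegralModel (valuationSubringAtPrime K v) K B.X).geomReductionMap (AlgPoints.map αd (lift x₁ x₂))) :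
        h.specialFibre.geomPoints) =
      (Additive.ofMul (AlgPoints.map ((specialFibreFunctor v).map 𝔞)
        (lift (𝒳.geomReductionMap x₁) (𝒴.geomReductionMap x₂) ≫ Functor.LaxMonoidal.μ (specialFibreFunctor v) 𝒳.total 𝒴.total)) :
          h.specialFibre.geomPoints) := by
  haveI := h.isProper
  haveI := IntegralModel.isProper_tensor_total 𝒳 𝒴
  rw [← IntegralModel.geomReductionMap_tensor_lift 𝒳 𝒴 x₁ x₂]
  exact h.integralModel_geomReductionMap_map_of_μ_additive 𝒳 𝒴 αd 𝔞 h𝔞 (lift x₁ x₂)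

/-! ### §1 Any carrier `∇X` with a cocycle `β : ∇X → B` extended to `αd : X × X → B` -/

namespace Nabla

omit [NumberField K] in
/-- Reflexivity of «`(p, q) ∈ ∇X(Ω)`»: the diagonal pair `(p, p)` lies on `∇X` (through `ΔX`, ★ `Nabla.diag_incl`).
[cite: Liu2021, §2.1 Def. 2.1 (1) (l. 1171–1174)] -/
theorem exists_comp_incl_eq_lift_self (N : Nabla X) {L : Type} [Field L] [Algebra K L] (p : AlgPoints X L) :
    ∃ z : AlgPoints N.N L, z ≫ N.incl = lift p p :=
  ⟨p ≫ N.diag, by rw [Category.assoc, N.diag_incl, comp_lift, Category.comp_id]⟩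

/-- **The difference function `θ` on the special fibre** ([Liu2021] App. D proof of Cor. D.9, p. 139; [DiamondShurman2005] Thm. 8.7.2 — the
«divisor of a difference» bookkeeping, model-theoretically).  Let `∇X ↪ X × X` be a TRANSITIVE carrier (★ `Nabla.IsTransitive`), `β : ∇X → B` a
cocycle (★ `Nabla.IsCocycle`) extended to `αd : X × X → B` (`incl ≫ αd = β`), `𝒜` an abelian-scheme model of `B` at `v`, `𝒮` a PROPER model of `X`
at `v` whose reduction map `red_𝒮 : X(Ω) → 𝒮_v(κ̄)` is SURJECTIVE (letter H) and SEPARATES `∇`-classes (`red p = red p′ ⇒ (p, p′) ∈ ∇X(Ω)`,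
letter π0), and `𝔞 : 𝒮 × 𝒮 → 𝒜` an `𝓞ᵥ`-morphism with generic fibre `αd` (μ-form of the letter `RecordCurveEichlerShimuraPointwise`).  Then there
is `θ : 𝒮_v(κ̄) → 𝒜_v(κ̄)` with `𝔞_v (red p, red q) = θ (red p) − θ (red q)` for every `(p, q) ∈ ∇X(Ω)`.  Proof: ★ (A)
`EichlerShimuraAssembly.exists_sub_eq_of_cocycle` with `αu p q := red_{⟨𝒜,e⟩} (αd (p, q))` (a cocycle on `∇`-triples: ★ cocycle identity + ★
`integralModel_geomReductionMap_mul`) and `αr = 𝔞_v` (C2: ★ `integralModel_geomReductionMap_map_of_μ_additive`, ★ `geomReductionMap_tensor_lift`).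
[cite: Liu2021, App. D proof of Cor. D.9 (print p. 139)] [cite: DiamondShurman2005, Thm. 8.7.2 (p. 353)] [cite: SerreTate1968, §1] -/
theorem exists_theta_of_isCocycle (N : Nabla X) (hN : N.IsTransitive) (β : N.N ⟶ B.X) (hβ : N.IsCocycle β)
    (αd : X ⊗ X ⟶ B.X) (hαd : N.incl ≫ αd = β) (h : IsAbelianSchemeModel B v 𝒜)
    (𝒮 : IntegralModel (valuationSubringAtPrime K v) K X) [IsProper 𝒮.total.hom] (𝔞 : 𝒮.total ⊗ 𝒮.total ⟶ 𝒜)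
    (h𝔞 : Functor.LaxMonoidal.μ (genericFibre (valuationSubringAtPrime K v) K) 𝒮.total 𝒮.total ≫
        (genericFibre (valuationSubringAtPrime K v) K).map 𝔞 ≫ h.exists_iso.choose.hom = (𝒮.genericIso.hom ⊗ₘ 𝒮.genericIso.hom) ≫ αd)
    (hH : Function.Surjective 𝒮.geomReductionMap)
    (hπ0 : ∀ p p' : AlgPoints X (AlgebraicClosure (v.adicCompletion K)), 𝒮.geomReductionMap p = 𝒮.geomReductionMap p' →
      ∃ z : AlgPoints N.N (AlgebraicClosure (v.adicCompletion K)), z ≫ N.incl = lift p p') :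
    ∃ θ : AlgPoints 𝒮.reductionAt (geomResidueField v) → h.specialFibre.geomPoints,
      ∀ (p q : AlgPoints X (AlgebraicClosure (v.adicCompletion K))) (z : AlgPoints N.N (AlgebraicClosure (v.adicCompletion K))),
        z ≫ N.incl = lift p q →
        (Additive.ofMul (AlgPoints.map ((specialFibreFunctor v).map 𝔞)
            (lift (𝒮.geomReductionMap p) (𝒮.geomReductionMap q) ≫ Functor.LaxMonoidal.μ (specialFibreFunctor v) 𝒮.total 𝒮.total)) :
          h.specialFibre.geomPoints) = θ (𝒮.geomReductionMap p) - θ (𝒮.geomReductionMap q) := by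
  classical
  haveI := h.isProper
  haveI := IntegralModel.isProper_tensor_total 𝒮 𝒮
  -- a `∇`-pair through `αd` is the cocycle value `z ≫ β`
  have hval : ∀ (p q : AlgPoints X (AlgebraicClosure (v.adicCompletion K)))
      (z : AlgPoints N.N (AlgebraicClosure (v.adicCompletion K))), z ≫ N.incl = lift p q →
      AlgPoints.map αd (lift p q) = z ≫ β := by
    intro p q z hz
    rw [AlgPoints.map_apply, ← hz, Category.assoc, hαd]
  -- the upstairs difference `αu p q := red_{⟨𝒜,e⟩} (αd (p, q))` is a cocycle on `∇`-triples (★ cocycle identity, ★ `red` a homomorphism)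
  have hcoc : ∀ p q r : AlgPoints X (AlgebraicClosure (v.adicCompletion K)),
      (∃ z : AlgPoints N.N (AlgebraicClosure (v.adicCompletion K)), z ≫ N.incl = lift p q) →
      (∃ z : AlgPoints N.N (AlgebraicClosure (v.adicCompletion K)), z ≫ N.incl = lift q r) →
      (Additive.ofMul ((⟨𝒜, h.exists_iso.choose⟩ : IntegralModel (valuationSubringAtPrime K v) K B.X).geomReductionMap
          (AlgPoints.map αd (lift p q))) : h.specialFibre.geomPoints) +
        (Additive.ofMul ((⟨𝒜, h.exists_iso.choose⟩ : IntegralModel (valuationSubringAtPrime K v) K B.X).geomReductionMap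
          (AlgPoints.map αd (lift q r))) : h.specialFibre.geomPoints) =
        (Additive.ofMul ((⟨𝒜, h.exists_iso.choose⟩ : IntegralModel (valuationSubringAtPrime K v) K B.X).geomReductionMap
          (AlgPoints.map αd (lift p r))) : h.specialFibre.geomPoints) := by
    rintro p q r ⟨pq, hpq⟩ ⟨qr, hqr⟩
    obtain ⟨pr, hpr⟩ := hN p q r pq qr hpq hqr
    rw [hval p q pq hpq, hval q r qr hqr, hval p r pr hpr, ← h.integralModel_geomReductionMap_mul,
      hβ p q r pq qr pr hpq hqr hpr]
  -- C2: the downstairs difference `𝔞_v (a, b)` agrees with `αu` on reductions (★ p793967 + ★ p794609)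
  have hαr : ∀ p q : AlgPoints X (AlgebraicClosure (v.adicCompletion K)),
      (Additive.ofMul (AlgPoints.map ((specialFibreFunctor v).map 𝔞)
          (lift (𝒮.geomReductionMap p) (𝒮.geomReductionMap q) ≫ Functor.LaxMonoidal.μ (specialFibreFunctor v) 𝒮.total 𝒮.total)) :
        h.specialFibre.geomPoints) =
        (Additive.ofMul ((⟨𝒜, h.exists_iso.choose⟩ : IntegralModel (valuationSubringAtPrime K v) K B.X).geomReductionMap
          (AlgPoints.map αd (lift p q))) : h.specialFibre.geomPoints) := by
    intro p q
    exact (h.integralModel_geomReductionMap_map_lift_geomPoints 𝒮 𝒮 αd 𝔞 h𝔞 p q).symm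
  obtain ⟨θ, hθ⟩ := EichlerShimuraAssembly.exists_sub_eq_of_cocycle (G := h.specialFibre.geomPoints)
    𝒮.geomReductionMap hH (fun p q => ∃ z : AlgPoints N.N (AlgebraicClosure (v.adicCompletion K)), z ≫ N.incl = lift p q)
    (fun p => N.exists_comp_incl_eq_lift_self p)
    (fun p q ⟨z, hz⟩ => N.exists_swap p q z hz)
    (fun p q r ⟨pq, hpq⟩ ⟨qr, hqr⟩ => hN p q r pq qr hpq hqr)
    hπ0
    (fun p q => (Additive.ofMul ((⟨𝒜, h.exists_iso.choose⟩ : IntegralModel (valuationSubringAtPrime K v) K B.X).geomReductionMap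
      (AlgPoints.map αd (lift p q))) : h.specialFibre.geomPoints))
    hcoc
    (fun a b => (Additive.ofMul (AlgPoints.map ((specialFibreFunctor v).map 𝔞)
      (lift a b ≫ Functor.LaxMonoidal.μ (specialFibreFunctor v) 𝒮.total 𝒮.total)) : h.specialFibre.geomPoints))
    (fun p q _ => hαr p q)
  exact ⟨θ, fun p q z hz => hθ p q ⟨z, hz⟩⟩

/-- **The summed form** (★ (A) `EichlerShimuraAssembly.sum_pairing_eq_of_multiset_eq_of_rel` with its ten structural arguments discharged
geometrically): under the hypotheses of `exists_theta_of_isCocycle`, for `∇`-pairs `(paᵢ, pbᵢ)` (`i ∈ s`), `(px, py)`, `(pcⱼ, pdⱼ)` (`j ∈ t`) of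
`Ω`-points of `X` whose reductions satisfy the two multiset identities `Σᵢ {red paᵢ} = {red px} + Σⱼ n • {red pcⱼ}` and
`Σᵢ {red pbᵢ} = {red py} + Σⱼ n • {red pdⱼ}` (letter C3 at two points), one has
`Σᵢ 𝔞_v (red paᵢ, red pbᵢ) = 𝔞_v (red px, red py) + n • Σⱼ 𝔞_v (red pcⱼ, red pdⱼ)` in `𝒜_v(κ̄)` — however the two orbits are PAIRED.
[cite: Liu2021, App. D proof of Cor. D.9 (print p. 139)] [cite: DiamondShurman2005, Thm. 8.7.2 (p. 353)] -/
theorem sum_pairing_eq_of_multiset_eq (N : Nabla X) (hN : N.IsTransitive) (β : N.N ⟶ B.X) (hβ : N.IsCocycle β)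
    (αd : X ⊗ X ⟶ B.X) (hαd : N.incl ≫ αd = β) (h : IsAbelianSchemeModel B v 𝒜)
    (𝒮 : IntegralModel (valuationSubringAtPrime K v) K X) [IsProper 𝒮.total.hom] (𝔞 : 𝒮.total ⊗ 𝒮.total ⟶ 𝒜)
    (h𝔞 : Functor.LaxMonoidal.μ (genericFibre (valuationSubringAtPrime K v) K) 𝒮.total 𝒮.total ≫
        (genericFibre (valuationSubringAtPrime K v) K).map 𝔞 ≫ h.exists_iso.choose.hom = (𝒮.genericIso.hom ⊗ₘ 𝒮.genericIso.hom) ≫ αd)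
    (hH : Function.Surjective 𝒮.geomReductionMap)
    (hπ0 : ∀ p p' : AlgPoints X (AlgebraicClosure (v.adicCompletion K)), 𝒮.geomReductionMap p = 𝒮.geomReductionMap p' →
      ∃ z : AlgPoints N.N (AlgebraicClosure (v.adicCompletion K)), z ≫ N.incl = lift p p')
    {I J : Type*} (s : Finset I) (t : Finset J)
    (pa pb : I → AlgPoints X (AlgebraicClosure (v.adicCompletion K)))
    (hab : ∀ i ∈ s, ∃ z : AlgPoints N.N (AlgebraicClosure (v.adicCompletion K)), z ≫ N.incl = lift (pa i) (pb i))
    (px py : AlgPoints X (AlgebraicClosure (v.adicCompletion K)))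
    (hxy : ∃ z : AlgPoints N.N (AlgebraicClosure (v.adicCompletion K)), z ≫ N.incl = lift px py)
    (pc pd : J → AlgPoints X (AlgebraicClosure (v.adicCompletion K)))
    (hcd : ∀ j ∈ t, ∃ z : AlgPoints N.N (AlgebraicClosure (v.adicCompletion K)), z ≫ N.incl = lift (pc j) (pd j)) (n : ℕ)
    (ha : ∑ i ∈ s, ({𝒮.geomReductionMap (pa i)} : Multiset (AlgPoints 𝒮.reductionAt (geomResidueField v))) =
      {𝒮.geomReductionMap px} + ∑ j ∈ t, n • ({𝒮.geomReductionMap (pc j)} : Multiset (AlgPoints 𝒮.reductionAt (geomResidueField v))))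
    (hb : ∑ i ∈ s, ({𝒮.geomReductionMap (pb i)} : Multiset (AlgPoints 𝒮.reductionAt (geomResidueField v))) =
      {𝒮.geomReductionMap py} + ∑ j ∈ t, n • ({𝒮.geomReductionMap (pd j)} : Multiset (AlgPoints 𝒮.reductionAt (geomResidueField v)))) :
    ∑ i ∈ s, (Additive.ofMul (AlgPoints.map ((specialFibreFunctor v).map 𝔞)
        (lift (𝒮.geomReductionMap (pa i)) (𝒮.geomReductionMap (pb i)) ≫ Functor.LaxMonoidal.μ (specialFibreFunctor v) 𝒮.total 𝒮.total)) :
          h.specialFibre.geomPoints) =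
      (Additive.ofMul (AlgPoints.map ((specialFibreFunctor v).map 𝔞)
          (lift (𝒮.geomReductionMap px) (𝒮.geomReductionMap py) ≫ Functor.LaxMonoidal.μ (specialFibreFunctor v) 𝒮.total 𝒮.total)) :
        h.specialFibre.geomPoints) +
      n • ∑ j ∈ t, (Additive.ofMul (AlgPoints.map ((specialFibreFunctor v).map 𝔞)
        (lift (𝒮.geomReductionMap (pc j)) (𝒮.geomReductionMap (pd j)) ≫ Functor.LaxMonoidal.μ (specialFibreFunctor v) 𝒮.total 𝒮.total)) :
          h.specialFibre.geomPoints) := by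
  obtain ⟨θ, hθ⟩ := N.exists_theta_of_isCocycle hN β hβ αd hαd h 𝒮 𝔞 h𝔞 hH hπ0
  exact EichlerShimuraAssembly.sum_pairing_eq_of_multiset_eq s t
    (fun a b => (Additive.ofMul (AlgPoints.map ((specialFibreFunctor v).map 𝔞)
      (lift a b ≫ Functor.LaxMonoidal.μ (specialFibreFunctor v) 𝒮.total 𝒮.total)) : h.specialFibre.geomPoints))
    θ (fun i => 𝒮.geomReductionMap (pa i)) (fun i => 𝒮.geomReductionMap (pb i))
    (fun i hi => by obtain ⟨z, hz⟩ := hab i hi; exact hθ _ _ z hz)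
    (𝒮.geomReductionMap px) (𝒮.geomReductionMap py) (by obtain ⟨z, hz⟩ := hxy; exact hθ _ _ z hz)
    (fun j => 𝒮.geomReductionMap (pc j)) (fun j => 𝒮.geomReductionMap (pd j))
    (fun j hj => by obtain ⟨z, hz⟩ := hcd j hj; exact hθ _ _ z hz) n ha hb

/-- **Upstairs reading of the summed form**: with the same data, `Σᵢ red_{⟨𝒜,e⟩} (αd (paᵢ, pbᵢ)) = red_{⟨𝒜,e⟩} (αd (px, py)) +
n • Σⱼ red_{⟨𝒜,e⟩} (αd (pcⱼ, pdⱼ))` in `𝒜_v(κ̄)` (every term rewritten by C2: ★ `integralModel_geomReductionMap_map_of_μ_additive` + ★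
`geomReductionMap_tensor_lift`). [cite: Liu2021, App. D proof of Cor. D.9 (print p. 139)] [cite: SerreTate1968, §1] -/
theorem sum_pairing_eq_of_multiset_eq_upstairs (N : Nabla X) (hN : N.IsTransitive) (β : N.N ⟶ B.X) (hβ : N.IsCocycle β)
    (αd : X ⊗ X ⟶ B.X) (hαd : N.incl ≫ αd = β) (h : IsAbelianSchemeModel B v 𝒜)
    (𝒮 : IntegralModel (valuationSubringAtPrime K v) K X) [IsProper 𝒮.total.hom] (𝔞 : 𝒮.total ⊗ 𝒮.total ⟶ 𝒜)
    (h𝔞 : Functor.LaxMonoidal.μ (genericFibre (valuationSubringAtPrime K v) K) 𝒮.total 𝒮.total ≫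
        (genericFibre (valuationSubringAtPrime K v) K).map 𝔞 ≫ h.exists_iso.choose.hom = (𝒮.genericIso.hom ⊗ₘ 𝒮.genericIso.hom) ≫ αd)
    (hH : Function.Surjective 𝒮.geomReductionMap)
    (hπ0 : ∀ p p' : AlgPoints X (AlgebraicClosure (v.adicCompletion K)), 𝒮.geomReductionMap p = 𝒮.geomReductionMap p' →
      ∃ z : AlgPoints N.N (AlgebraicClosure (v.adicCompletion K)), z ≫ N.incl = lift p p')
    {I J : Type*} (s : Finset I) (t : Finset J)
    (pa pb : I → AlgPoints X (AlgebraicClosure (v.adicCompletion K)))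
    (hab : ∀ i ∈ s, ∃ z : AlgPoints N.N (AlgebraicClosure (v.adicCompletion K)), z ≫ N.incl = lift (pa i) (pb i))
    (px py : AlgPoints X (AlgebraicClosure (v.adicCompletion K)))
    (hxy : ∃ z : AlgPoints N.N (AlgebraicClosure (v.adicCompletion K)), z ≫ N.incl = lift px py)
    (pc pd : J → AlgPoints X (AlgebraicClosure (v.adicCompletion K)))
    (hcd : ∀ j ∈ t, ∃ z : AlgPoints N.N (AlgebraicClosure (v.adicCompletion K)), z ≫ N.incl = lift (pc j) (pd j)) (n : ℕ)
    (ha : ∑ i ∈ s, ({𝒮.geomReductionMap (pa i)} : Multiset (AlgPoints 𝒮.reductionAt (geomResidueField v))) =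
      {𝒮.geomReductionMap px} + ∑ j ∈ t, n • ({𝒮.geomReductionMap (pc j)} : Multiset (AlgPoints 𝒮.reductionAt (geomResidueField v))))
    (hb : ∑ i ∈ s, ({𝒮.geomReductionMap (pb i)} : Multiset (AlgPoints 𝒮.reductionAt (geomResidueField v))) =
      {𝒮.geomReductionMap py} + ∑ j ∈ t, n • ({𝒮.geomReductionMap (pd j)} : Multiset (AlgPoints 𝒮.reductionAt (geomResidueField v)))) :
    ∑ i ∈ s, (Additive.ofMul (haveI := h.isProper
        (⟨𝒜, h.exists_iso.choose⟩ : IntegralModel (valuationSubringAtPrime K v) K B.X).geomReductionMap (AlgPoints.map αd (lift (pa i) (pb i)))) :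
          h.specialFibre.geomPoints) =
      (Additive.ofMul (haveI := h.isProper
        (⟨𝒜, h.exists_iso.choose⟩ : IntegralModel (valuationSubringAtPrime K v) K B.X).geomReductionMap (AlgPoints.map αd (lift px py))) :
          h.specialFibre.geomPoints) +
      n • ∑ j ∈ t, (Additive.ofMul (haveI := h.isProper
        (⟨𝒜, h.exists_iso.choose⟩ : IntegralModel (valuationSubringAtPrime K v) K B.X).geomReductionMap (AlgPoints.map αd (lift (pc j) (pd j)))) :
          h.specialFibre.geomPoints) := by
  haveI := h.isProper
  haveI := IntegralModel.isProper_tensor_total 𝒮 𝒮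
  have hC2 : ∀ p q : AlgPoints X (AlgebraicClosure (v.adicCompletion K)),
      (Additive.ofMul ((⟨𝒜, h.exists_iso.choose⟩ : IntegralModel (valuationSubringAtPrime K v) K B.X).geomReductionMap
          (AlgPoints.map αd (lift p q))) : h.specialFibre.geomPoints) =
        Additive.ofMul (AlgPoints.map ((specialFibreFunctor v).map 𝔞)
          (lift (𝒮.geomReductionMap p) (𝒮.geomReductionMap q) ≫ Functor.LaxMonoidal.μ (specialFibreFunctor v) 𝒮.total 𝒮.total)) := by
    intro p q
    exact h.integralModel_geomReductionMap_map_lift_geomPoints 𝒮 𝒮 αd 𝔞 h𝔞 p q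
  simp only [hC2]
  exact N.sum_pairing_eq_of_multiset_eq hN β hβ αd hαd h 𝒮 𝔞 h𝔞 hH hπ0 s t pa pb hab px py hxy pc pd hcd n ha hb

end Nabla

/-! ### §2 The Albanese datum of a smooth projective scheme (cocycle and transitivity by ★) -/

namespace Albanese

/-- **`θ` for the Albanese difference morphism** ([Liu2021] Def. 2.3, App. D p. 139): for `X` smooth of some relative dimension and projective
over the number field `K`, an Albanese datum `aX` (★ `AppendixC.Albanese`), an extension `αd : X × X → Alb_X` of `α_X` (`∇X ↪ X × X ≫ αd = α_X`,
★ `Albanese.exists_albDiff`), an abelian-scheme model `𝒜` of `Alb_X` at `v`, a PROPER model `𝒮` of `X` with SURJECTIVE reduction map separating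
`∇`-classes, and an `𝓞ᵥ`-morphism `𝔞 : 𝒮 × 𝒮 → 𝒜` with generic fibre `αd`: there is `θ : 𝒮_v(κ̄) → 𝒜_v(κ̄)` with
`𝔞_v (red p, red q) = θ (red p) − θ (red q)` for all `(p, q) ∈ ∇X(Ω)`.  The cocycle identity is ★ `Albanese.isCocycle_of_isProjectiveOver'`,
transitivity of `∇X` is ★ `Nabla.isTransitive_of_isProjectiveOver`. [cite: Liu2021, Def. 2.3 (l. 1202–1208) and App. D proof of Cor. D.9 (print p. 139)]
[cite: DiamondShurman2005, Thm. 8.7.2 (p. 353)] -/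
theorem exists_theta {d : ℕ} [SmoothOfRelativeDimension d X.hom] (hX : IsProjectiveOver X) (aX : Albanese X)
    (αd : X ⊗ X ⟶ aX.Alb.X) (hαd : aX.nabla.incl ≫ αd = aX.α) (h : IsAbelianSchemeModel aX.Alb v 𝒜)
    (𝒮 : IntegralModel (valuationSubringAtPrime K v) K X) [IsProper 𝒮.total.hom] (𝔞 : 𝒮.total ⊗ 𝒮.total ⟶ 𝒜)
    (h𝔞 : Functor.LaxMonoidal.μ (genericFibre (valuationSubringAtPrime K v) K) 𝒮.total 𝒮.total ≫
        (genericFibre (valuationSubringAtPrime K v) K).map 𝔞 ≫ h.exists_iso.choose.hom = (𝒮.genericIso.hom ⊗ₘ 𝒮.genericIso.hom) ≫ αd)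
    (hH : Function.Surjective 𝒮.geomReductionMap)
    (hπ0 : ∀ p p' : AlgPoints X (AlgebraicClosure (v.adicCompletion K)), 𝒮.geomReductionMap p = 𝒮.geomReductionMap p' →
      ∃ z : AlgPoints aX.nabla.N (AlgebraicClosure (v.adicCompletion K)), z ≫ aX.nabla.incl = lift p p') :
    ∃ θ : AlgPoints 𝒮.reductionAt (geomResidueField v) → h.specialFibre.geomPoints,
      ∀ (p q : AlgPoints X (AlgebraicClosure (v.adicCompletion K))) (z : AlgPoints aX.nabla.N (AlgebraicClosure (v.adicCompletion K))),
        z ≫ aX.nabla.incl = lift p q →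
        (Additive.ofMul (AlgPoints.map ((specialFibreFunctor v).map 𝔞)
            (lift (𝒮.geomReductionMap p) (𝒮.geomReductionMap q) ≫ Functor.LaxMonoidal.μ (specialFibreFunctor v) 𝒮.total 𝒮.total)) :
          h.specialFibre.geomPoints) = θ (𝒮.geomReductionMap p) - θ (𝒮.geomReductionMap q) :=
  aX.nabla.exists_theta_of_isCocycle (Nabla.isTransitive_of_isProjectiveOver (d := d) hX aX.nabla) aX.α
    (Albanese.isCocycle_of_isProjectiveOver' (d := d) hX aX) αd hαd h 𝒮 𝔞 h𝔞 hH hπ0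

/-- The same with the letter's binder `h𝒮 : 𝒮.IsSmoothProper e` supplying properness (`haveI := h𝒮.2`, as in the letters
`RecordCurveEichlerShimuraPointwise` / `SmoothProperModelSeparatesNabla` of `Cruxes/HLiu418/Lines/F0_D9opRoad2.lean`).
[cite: Liu2021, Def. 2.3 (l. 1202–1208) and App. D proof of Cor. D.9 (print p. 139)] [cite: DiamondShurman2005, Thm. 8.7.2 (p. 353)] -/
theorem exists_theta_of_isSmoothProper {d : ℕ} [SmoothOfRelativeDimension d X.hom] (hX : IsProjectiveOver X) (aX : Albanese X)
    (αd : X ⊗ X ⟶ aX.Alb.X) (hαd : aX.nabla.incl ≫ αd = aX.α) (h : IsAbelianSchemeModel aX.Alb v 𝒜)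
    (𝒮 : IntegralModel (valuationSubringAtPrime K v) K X) {e : ℕ} (h𝒮 : 𝒮.IsSmoothProper e) (𝔞 : 𝒮.total ⊗ 𝒮.total ⟶ 𝒜)
    (h𝔞 : Functor.LaxMonoidal.μ (genericFibre (valuationSubringAtPrime K v) K) 𝒮.total 𝒮.total ≫
        (genericFibre (valuationSubringAtPrime K v) K).map 𝔞 ≫ h.exists_iso.choose.hom = (𝒮.genericIso.hom ⊗ₘ 𝒮.genericIso.hom) ≫ αd)
    (hH : Function.Surjective (haveI := h𝒮.2; 𝒮.geomReductionMap))
    (hπ0 : ∀ p p' : AlgPoints X (AlgebraicClosure (v.adicCompletion K)),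
      (haveI := h𝒮.2; 𝒮.geomReductionMap p = 𝒮.geomReductionMap p') →
      ∃ z : AlgPoints aX.nabla.N (AlgebraicClosure (v.adicCompletion K)), z ≫ aX.nabla.incl = lift p p') :
    ∃ θ : AlgPoints 𝒮.reductionAt (geomResidueField v) → h.specialFibre.geomPoints,
      ∀ (p q : AlgPoints X (AlgebraicClosure (v.adicCompletion K))) (z : AlgPoints aX.nabla.N (AlgebraicClosure (v.adicCompletion K))),
        z ≫ aX.nabla.incl = lift p q →
        (Additive.ofMul (AlgPoints.map ((specialFibreFunctor v).map 𝔞)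
            (lift (haveI := h𝒮.2; 𝒮.geomReductionMap p) (haveI := h𝒮.2; 𝒮.geomReductionMap q) ≫
              Functor.LaxMonoidal.μ (specialFibreFunctor v) 𝒮.total 𝒮.total)) :
          h.specialFibre.geomPoints) = θ (haveI := h𝒮.2; 𝒮.geomReductionMap p) - θ (haveI := h𝒮.2; 𝒮.geomReductionMap q) := by
  haveI := h𝒮.2
  exact aX.exists_theta (d := d) hX αd hαd h 𝒮 𝔞 h𝔞 hH hπ0

/-- **The summed form for the Albanese datum** (★ (A) with all structural arguments discharged; the form consumed per `δ ∈ K∕N` by the ED. 4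
composition): for `∇`-pairs `(paᵢ, pbᵢ)`, `(px, py)`, `(pcⱼ, pdⱼ)` whose reductions satisfy the two multiset identities of letter C3,
`Σᵢ 𝔞_v (red paᵢ, red pbᵢ) = 𝔞_v (red px, red py) + n • Σⱼ 𝔞_v (red pcⱼ, red pdⱼ)`. [cite: Liu2021, App. D proof of Cor. D.9 (print p. 139)]
[cite: DiamondShurman2005, Thm. 8.7.2 (p. 353)] -/
theorem sum_pairing_eq_of_multiset_eq {d : ℕ} [SmoothOfRelativeDimension d X.hom] (hX : IsProjectiveOver X) (aX : Albanese X)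
    (αd : X ⊗ X ⟶ aX.Alb.X) (hαd : aX.nabla.incl ≫ αd = aX.α) (h : IsAbelianSchemeModel aX.Alb v 𝒜)
    (𝒮 : IntegralModel (valuationSubringAtPrime K v) K X) [IsProper 𝒮.total.hom] (𝔞 : 𝒮.total ⊗ 𝒮.total ⟶ 𝒜)
    (h𝔞 : Functor.LaxMonoidal.μ (genericFibre (valuationSubringAtPrime K v) K) 𝒮.total 𝒮.total ≫
        (genericFibre (valuationSubringAtPrime K v) K).map 𝔞 ≫ h.exists_iso.choose.hom = (𝒮.genericIso.hom ⊗ₘ 𝒮.genericIso.hom) ≫ αd)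
    (hH : Function.Surjective 𝒮.geomReductionMap)
    (hπ0 : ∀ p p' : AlgPoints X (AlgebraicClosure (v.adicCompletion K)), 𝒮.geomReductionMap p = 𝒮.geomReductionMap p' →
      ∃ z : AlgPoints aX.nabla.N (AlgebraicClosure (v.adicCompletion K)), z ≫ aX.nabla.incl = lift p p')
    {I J : Type*} (s : Finset I) (t : Finset J)
    (pa pb : I → AlgPoints X (AlgebraicClosure (v.adicCompletion K)))
    (hab : ∀ i ∈ s, ∃ z : AlgPoints aX.nabla.N (AlgebraicClosure (v.adicCompletion K)), z ≫ aX.nabla.incl = lift (pa i) (pb i))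
    (px py : AlgPoints X (AlgebraicClosure (v.adicCompletion K)))
    (hxy : ∃ z : AlgPoints aX.nabla.N (AlgebraicClosure (v.adicCompletion K)), z ≫ aX.nabla.incl = lift px py)
    (pc pd : J → AlgPoints X (AlgebraicClosure (v.adicCompletion K)))
    (hcd : ∀ j ∈ t, ∃ z : AlgPoints aX.nabla.N (AlgebraicClosure (v.adicCompletion K)), z ≫ aX.nabla.incl = lift (pc j) (pd j)) (n : ℕ)
    (ha : ∑ i ∈ s, ({𝒮.geomReductionMap (pa i)} : Multiset (AlgPoints 𝒮.reductionAt (geomResidueField v))) =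
      {𝒮.geomReductionMap px} + ∑ j ∈ t, n • ({𝒮.geomReductionMap (pc j)} : Multiset (AlgPoints 𝒮.reductionAt (geomResidueField v))))
    (hb : ∑ i ∈ s, ({𝒮.geomReductionMap (pb i)} : Multiset (AlgPoints 𝒮.reductionAt (geomResidueField v))) =
      {𝒮.geomReductionMap py} + ∑ j ∈ t, n • ({𝒮.geomReductionMap (pd j)} : Multiset (AlgPoints 𝒮.reductionAt (geomResidueField v)))) :
    ∑ i ∈ s, (Additive.ofMul (AlgPoints.map ((specialFibreFunctor v).map 𝔞)
        (lift (𝒮.geomReductionMap (pa i)) (𝒮.geomReductionMap (pb i)) ≫ Functor.LaxMonoidal.μ (specialFibreFunctor v) 𝒮.total 𝒮.total)) :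
          h.specialFibre.geomPoints) =
      (Additive.ofMul (AlgPoints.map ((specialFibreFunctor v).map 𝔞)
          (lift (𝒮.geomReductionMap px) (𝒮.geomReductionMap py) ≫ Functor.LaxMonoidal.μ (specialFibreFunctor v) 𝒮.total 𝒮.total)) :
        h.specialFibre.geomPoints) +
      n • ∑ j ∈ t, (Additive.ofMul (AlgPoints.map ((specialFibreFunctor v).map 𝔞)
        (lift (𝒮.geomReductionMap (pc j)) (𝒮.geomReductionMap (pd j)) ≫ Functor.LaxMonoidal.μ (specialFibreFunctor v) 𝒮.total 𝒮.total)) :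
          h.specialFibre.geomPoints) :=
  aX.nabla.sum_pairing_eq_of_multiset_eq (Nabla.isTransitive_of_isProjectiveOver (d := d) hX aX.nabla) aX.α
    (Albanese.isCocycle_of_isProjectiveOver' (d := d) hX aX) αd hαd h 𝒮 𝔞 h𝔞 hH hπ0 s t pa pb hab px py hxy pc pd hcd n ha hb

end Albanese

end Literature.NumberTheory.Automorphic.Liu2021.AppendixC

end
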